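import Summits.ABC.IUTFork.Conditional.AbcOfSOrNumKContent
import Summits.ABC.IUTFork.Conditional.AbcOfSOrNumKMix
import HarnessLib

/-!
# Branch C, K line — the STABLE COMPANION OF RECORD WITH NO CONE BINDER (`abc_of_SH_orNum_K_szpiroBad_mix`, p457468) with BOTH binders CUT TO
# THE CONTENT LOCUS OF [IUTchIV] Thm. 1.10's DISPLAY («θ-cut»; C-lead rulings C-R44 / C-R45: the θ successor of record; explicit 2 = `hNumOffC` · `hSqMixC`; CONE 0)

C scoreboard (abc-iut-C-cert-1 gen 3, EVEN-revision writer; sequel to `Conditional/AbcOfSOrNumKContent.lean` (θ-cut of p452637, p459802) and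
`Conditional/AbcOfSGenuineKWindowThetaContent.lean` (θ-cut of the window record p453137, p460293); parent = abc-iut-C-cert-2's
`Conditional.abc_of_SH_orNum_K_szpiroBad_mix` (p457468, STABLE COMPANION OF RECORD by C-R40: explicit 2 = hNumOffBad · hSqMix, CONE 0 — off
abc-iut-s2-p1's mixing locus the hull estimate with `B_III` is the THEOREM `Conditional.hvol_offMixingLocus_holds`, p455026)). PROOF-ONLY (no `def`,
no new `Prop`, no instance, no notation; nothing re-typed; DATA binders, the mixing-locus text and the per-datum step are p457468's VERBATIM).

THE CUT (arithmetic in `AbcOfSOrNumKContent`). At an admissible `(P, l)` OFF the content locus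
«`6·(1 + 20·d_mod/l)·(log-diff + log-cond) + 120·d*_mod·l < log q^{∤{2,l}}(λ)`» the display `Cor22.Display P l η` that the chain consumes holds
for every `η > 0` by its own additive constant `20·(d*_mod·l + η)` (`display_of_not_content`), so NOTHING is needed there; the content guard implies
the Szpiro-bad guard (`szpiroBad_of_content`), so each binder below is WEAKER-OR-EQUAL than p457468's (C-R2) and the count is unchanged:

* **`abc_of_SH_orNum_K_mix_content`** — p457468 with `hNumOffBad ↦ hNumOffC` and `hSqMix ↦ hSqMixC`: the Szpiro-bad antecedent of both binders
  REPLACED by the content guard, everything else VERBATIM. Per admissible `(P, l)` on the content locus: `Cor22.Cor312AtDatum P l` per datum from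
  the licence (abc-iut-C-cert-3's `GenuineK.cor312Of_of_SH`, Θ-READ by abc-iut-s2-p6 p447368) or `hNumOffC`; OFF the mixing locus the hull
  estimate is p455026's theorem and the squeeze follows by abc-iut-S2's `PointDict.logQAvoid_le_of_cor312AtDatum`; ON it `hSqMixC`; tail
  `ABC_of_squeezeIII_content` (`thm110Legendre_of_pointwise` + `display_of_squeezeIII` + `ABC_of_thm110Legendre`). The Szpiro-GOOD branch of
  p457468 is not needed (a Szpiro-good point is off the content locus). Explicit 2 = NUM-OFF(content) 1 · NUM-1.10(content ∧ mixing) 1; CONE 0 ·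
  READ 0 · PIN 0 · SIDE 0.

WHAT IT BUYS / HONEST STRENGTH (numbers, not adjectives). NO hypothesis of any class is consumed at any admissible `(P, l)` with
`log q^{∤{2,l}}(λ) ≤ 120·d*_mod·l = 6.6·10⁷·d_mod·l` (`≥ 4.6·10⁸` nats, `l ≥ 7` by (P6)), nor at any Szpiro-good one, nor — for the second binder —
off the mixing locus: the certificate consumes nothing at any known abc triple or tabulated datum (all have `log q < 10⁴`), and a kernel
refutation of a record's binder AT KNOWN DATA cannot touch it. Conversely its binders live exactly where print's Thm. 1.10 has content; there
they are neither instantiated nor refuted (`hSqMixC` would be refuted only by a symbolic bounded-degree family of log-height `≥ 4.6·10⁸` provably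
on the locus violating a Szpiro-type inequality with coefficient `≈ 6(1 + 12·d_mod/l)` — an abc-type statement; abc-iut-s2-p1's floor 16:41Z).
HONEST FRAMING: locates / conditionally verifies; nothing here asserts that abc is proved or refuted, or that [IUTchIII] Cor. 3.12 / Thm. 3.11 or
[IUTchIV] Thm. 1.10 holds or fails at any datum, or takes a side on any author (Mochizuki / Scholze–Stix / Joshi / Dupuy–Hilado); `hNumOffC` /
`hSqMixC` are assumption labels, never asserted; SHARP reading (U); a cut discharges nothing; typed ≠ proved; instantiated ≠ endorsed;
refuted-as-typed ≠ refuted-in-print. [claim: Mochizuki2012, status: disputed]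
[cite: Mochizuki2012, IUTchIII Cor. 3.12 p. 173–174, Step (xi-f) p. 184; IUTchIV Thm. 1.10 p. 22–23 (display), Steps (ii)–(viii) p. 24–30,
Cor. 2.2 (ii)–(iii) p. 43–47 (p. 46 l. 1)] [cite: DupuyHilado2025, §3.3, §3.6, §4.7]
-/

noncomputable section

open Set Function NumberField IsDedekindDomain

namespace Summit.ABC.IUTFork.Conditional

open Thm311 Thm311.Real Cor312 Cor312Vol Cor312Prov Literature.IUT.LogThetaLattice Literature.IUT.LogVolume
  Literature.IUT.HodgeTheaters Literature.IUT.LogVolume.ThetaData Literature.NumberTheory.NumberFields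
open Literature.NumberTheory.DiophantineGeometry.GenEll Summit.ABC.ABC.Theorems
open scoped Classical

/-- **`abc_of_SH_orNum_K_mix_content`** — `ABC` from, per admissible `(P, l)` ON THE CONTENT LOCUS of [IUTchIV] Thm. 1.10's display
(`6·(1 + 20·d_mod/l)·(log-diff + log-cond) + 120·d*_mod·l < log q^{∤{2,l}}(λ)`): [NUM-OFF] at every genuine datum `T` where OUR typed (xi-f)
licence FAILS (chosen realising ideles, pinned reading), `T.Cor312Of` (`hNumOffC`) · [NUM-1.10, mixing] if `(P, l)` lies in abc-iut-s2-p1's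
kernel-stated MIXING LOCUS, [IUTchIV] Thm. 1.10 Step (viii)'s squeeze at the point (`hSqMixC`) — abc-iut-C-cert-2's p457468 with the Szpiro-bad
antecedent of both binders replaced by the (stronger) content guard, everything else VERBATIM. NO hypothesis about our hull (off the mixing
locus the `B_III` estimate is p455026's theorem); off the content locus — in particular at every point with `log q^{∤{2,l}}(λ) ≤ 120·d*_mod·l`,
hence at every known point — NOTHING is assumed. Explicit 2; CONE 0. «`ABC` follows from these hypotheses as typed» — no side taken on
[IUTchIII] Cor. 3.12 or [IUTchIV] Thm. 1.10; typed ≠ proved; instantiated ≠ endorsed. [claim: Mochizuki2012, status: disputed]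
[cite: Mochizuki2012, IUTchIV Thm. 1.10 Step (viii) p. 30] -/
theorem abc_of_SH_orNum_K_mix_content
    (M : ∀ (P : NFPoint) (l : ℕ) (T : Cor22.ThetaVolumeDatumAt P l), Type) [∀ P l T, Field (M P l T)] [∀ P l T, NumberField (M P l T)]
    (archPk : ∀ (P : NFPoint) (l : ℕ) (T : Cor22.ThetaVolumeDatumAt P l), letI := T.instFieldF; letI := T.instNumberFieldF; letI := T.instAlgebraF; letI := T.instFieldK;
        letI := T.instNumberFieldK; letI := T.instAlgebraK; letI := T.instFieldFbar; letI := T.instAlgebraFbar;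
        letI := T.instAlgebraKFbar; letI := T.instIsElliptic;
      ∀ (j : (thetaIndex (pilotDataOfK T.D T.K)).Label) (vQ : (thetaIndex (pilotDataOfK T.D T.K)).VQ), Set ((logShellsDH (pilotDataOfK T.D T.K) (analyticLogv T.K)).Packet j vQ))
    (archSub : ∀ (P : NFPoint) (l : ℕ) (T : Cor22.ThetaVolumeDatumAt P l), letI := T.instFieldF; letI := T.instNumberFieldF; letI := T.instAlgebraF; letI := T.instFieldK;
        letI := T.instNumberFieldK; letI := T.instAlgebraK; letI := T.instFieldFbar; letI := T.instAlgebraFbar;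
        letI := T.instAlgebraKFbar; letI := T.instIsElliptic;
      ∀ (j : (thetaIndex (pilotDataOfK T.D T.K)).Label) (v : (thetaIndex (pilotDataOfK T.D T.K)).V), Set ((logShellsDH (pilotDataOfK T.D T.K) (analyticLogv T.K)).Packet j ((thetaIndex (pilotDataOfK T.D T.K)).over v)))
    (Ψ : ∀ (P : NFPoint) (l : ℕ) (T : Cor22.ThetaVolumeDatumAt P l), letI := T.instFieldF; letI := T.instNumberFieldF; letI := T.instAlgebraF; letI := T.instFieldK;
        letI := T.instNumberFieldK; letI := T.instAlgebraK; letI := T.instFieldFbar; letI := T.instAlgebraFbar;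
        letI := T.instAlgebraKFbar; letI := T.instIsElliptic;
      ℤ → ∀ v : (thetaIndex (pilotDataOfK T.D T.K)).V, v ∈ (thetaIndex (pilotDataOfK T.D T.K)).Vbad → Set ((logShellsDH (pilotDataOfK T.D T.K) (analyticLogv T.K)).StarPacket v))
    (act : ∀ (P : NFPoint) (l : ℕ) (T : Cor22.ThetaVolumeDatumAt P l), letI := T.instFieldF; letI := T.instNumberFieldF; letI := T.instAlgebraF; letI := T.instFieldK;
        letI := T.instNumberFieldK; letI := T.instAlgebraK; letI := T.instFieldFbar; letI := T.instAlgebraFbar;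
        letI := T.instAlgebraKFbar; letI := T.instIsElliptic;
      ℤ → ∀ v : (thetaIndex (pilotDataOfK T.D T.K)).V, v ∈ (thetaIndex (pilotDataOfK T.D T.K)).Vbad → (logShellsDH (pilotDataOfK T.D T.K) (analyticLogv T.K)).StarPacket v → Module.End ℚ ((logShellsDH (pilotDataOfK T.D T.K) (analyticLogv T.K)).StarPacket v))
    (Mmod : ∀ (P : NFPoint) (l : ℕ) (T : Cor22.ThetaVolumeDatumAt P l), letI := T.instFieldF; letI := T.instNumberFieldF; letI := T.instAlgebraF; letI := T.instFieldK;
        letI := T.instNumberFieldK; letI := T.instAlgebraK; letI := T.instFieldFbar; letI := T.instAlgebraFbar;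
        letI := T.instAlgebraKFbar; letI := T.instIsElliptic;
      ℤ → ∀ j : (thetaIndex (pilotDataOfK T.D T.K)).LabelStar, Set ((logShellsDH (pilotDataOfK T.D T.K) (analyticLogv T.K)).GlobalPacket j.1))
    (region : ∀ (P : NFPoint) (l : ℕ) (T : Cor22.ThetaVolumeDatumAt P l), letI := T.instFieldF; letI := T.instNumberFieldF; letI := T.instAlgebraF; letI := T.instFieldK;
        letI := T.instNumberFieldK; letI := T.instAlgebraK; letI := T.instFieldFbar; letI := T.instAlgebraFbar;
        letI := T.instAlgebraKFbar; letI := T.instIsElliptic;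
      ℤ → ∀ j : (thetaIndex (pilotDataOfK T.D T.K)).LabelStar, FinDivisor (M P l T) → ∀ vQ : (thetaIndex (pilotDataOfK T.D T.K)).VQ, Set ((logShellsDH (pilotDataOfK T.D T.K) (analyticLogv T.K)).Packet j.1 vQ))
    (frobAdm : ∀ (P : NFPoint) (l : ℕ) (T : Cor22.ThetaVolumeDatumAt P l), letI := T.instFieldF; letI := T.instNumberFieldF; letI := T.instAlgebraF; letI := T.instFieldK;
        letI := T.instNumberFieldK; letI := T.instAlgebraK; letI := T.instFieldFbar; letI := T.instAlgebraFbar;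
        letI := T.instAlgebraKFbar; letI := T.instIsElliptic;
      ℤ → ℤ → ∀ (j : (thetaIndex (pilotDataOfK T.D T.K)).Label) (vQ : (thetaIndex (pilotDataOfK T.D T.K)).VQ), Set ((logShellsDH (pilotDataOfK T.D T.K) (analyticLogv T.K)).Packet j vQ) → Prop)
    (frobLogvol : ∀ (P : NFPoint) (l : ℕ) (T : Cor22.ThetaVolumeDatumAt P l), letI := T.instFieldF; letI := T.instNumberFieldF; letI := T.instAlgebraF; letI := T.instFieldK;
        letI := T.instNumberFieldK; letI := T.instAlgebraK; letI := T.instFieldFbar; letI := T.instAlgebraFbar;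
        letI := T.instAlgebraKFbar; letI := T.instIsElliptic;
      ℤ → ℤ → ∀ (j : (thetaIndex (pilotDataOfK T.D T.K)).Label) (vQ : (thetaIndex (pilotDataOfK T.D T.K)).VQ), Set ((logShellsDH (pilotDataOfK T.D T.K) (analyticLogv T.K)).Packet j vQ) → ℝ)
    (frobΨ : ∀ (P : NFPoint) (l : ℕ) (T : Cor22.ThetaVolumeDatumAt P l), letI := T.instFieldF; letI := T.instNumberFieldF; letI := T.instAlgebraF; letI := T.instFieldK;
        letI := T.instNumberFieldK; letI := T.instAlgebraK; letI := T.instFieldFbar; letI := T.instAlgebraFbar;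
        letI := T.instAlgebraKFbar; letI := T.instIsElliptic;
      ℤ → ℤ → ∀ v : (thetaIndex (pilotDataOfK T.D T.K)).V, v ∈ (thetaIndex (pilotDataOfK T.D T.K)).Vbad → Set ((logShellsDH (pilotDataOfK T.D T.K) (analyticLogv T.K)).StarPacket v))
    (frobMmod : ∀ (P : NFPoint) (l : ℕ) (T : Cor22.ThetaVolumeDatumAt P l), letI := T.instFieldF; letI := T.instNumberFieldF; letI := T.instAlgebraF; letI := T.instFieldK;
        letI := T.instNumberFieldK; letI := T.instAlgebraK; letI := T.instFieldFbar; letI := T.instAlgebraFbar;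
        letI := T.instAlgebraKFbar; letI := T.instIsElliptic;
      ℤ → ℤ → ∀ j : (thetaIndex (pilotDataOfK T.D T.K)).LabelStar, Set ((logShellsDH (pilotDataOfK T.D T.K) (analyticLogv T.K)).GlobalPacket j.1))
    (unitImage : ∀ (P : NFPoint) (l : ℕ) (T : Cor22.ThetaVolumeDatumAt P l), letI := T.instFieldF; letI := T.instNumberFieldF; letI := T.instAlgebraF; letI := T.instFieldK;
        letI := T.instNumberFieldK; letI := T.instAlgebraK; letI := T.instFieldFbar; letI := T.instAlgebraFbar;
        letI := T.instAlgebraKFbar; letI := T.instIsElliptic;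
      ℤ → ℤ → ℕ → ∀ (j : (thetaIndex (pilotDataOfK T.D T.K)).Label) (vQ : (thetaIndex (pilotDataOfK T.D T.K)).VQ), Set ((logShellsDH (pilotDataOfK T.D T.K) (analyticLogv T.K)).Packet j vQ))
    (ballImage : ∀ (P : NFPoint) (l : ℕ) (T : Cor22.ThetaVolumeDatumAt P l), letI := T.instFieldF; letI := T.instNumberFieldF; letI := T.instAlgebraF; letI := T.instFieldK;
        letI := T.instNumberFieldK; letI := T.instAlgebraK; letI := T.instFieldFbar; letI := T.instAlgebraFbar;
        letI := T.instAlgebraKFbar; letI := T.instIsElliptic;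
      ℤ → ℤ → ∀ (j : (thetaIndex (pilotDataOfK T.D T.K)).Label) (vQ : (thetaIndex (pilotDataOfK T.D T.K)).VQ), Set ((logShellsDH (pilotDataOfK T.D T.K) (analyticLogv T.K)).Packet j vQ))
    (thetaDiv : ∀ (P : NFPoint) (l : ℕ) (T : Cor22.ThetaVolumeDatumAt P l), letI := T.instFieldF; letI := T.instNumberFieldF; letI := T.instAlgebraF; letI := T.instFieldK;
        letI := T.instNumberFieldK; letI := T.instAlgebraK; letI := T.instFieldFbar; letI := T.instAlgebraFbar;
        letI := T.instAlgebraKFbar; letI := T.instIsElliptic;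
      ℤ → ℤ → LgpDivisor (M P l T) (thetaIndex (pilotDataOfK T.D T.K)).lstar)
    (n : ∀ (P : NFPoint) (l : ℕ) (T : Cor22.ThetaVolumeDatumAt P l), ℤ)
    {HT : ∀ (P : NFPoint) (l : ℕ) (T : Cor22.ThetaVolumeDatumAt P l), Type} {LogLink : ∀ (P : NFPoint) (l : ℕ) (T : Cor22.ThetaVolumeDatumAt P l), HT P l T → HT P l T → Type}
    {IsFull : ∀ (P : NFPoint) (l : ℕ) (T : Cor22.ThetaVolumeDatumAt P l), ∀ {s t : HT P l T}, LogLink P l T s t → Prop}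
    (lat : ∀ (P : NFPoint) (l : ℕ) (T : Cor22.ThetaVolumeDatumAt P l), LGPGaussianLogThetaLattice (LogLink P l T) (IsFull P l T))
    {Frd : ∀ (P : NFPoint) (l : ℕ) (T : Cor22.ThetaVolumeDatumAt P l), Type} {IsoF : ∀ (P : NFPoint) (l : ℕ) (T : Cor22.ThetaVolumeDatumAt P l), Frd P l T → Frd P l T → Type} {Ob : ∀ (P : NFPoint) (l : ℕ) (T : Cor22.ThetaVolumeDatumAt P l), Frd P l T → Type}
    {realify : ∀ (P : NFPoint) (l : ℕ) (T : Cor22.ThetaVolumeDatumAt P l), Frd P l T → Frd P l T} {Strip : ∀ (P : NFPoint) (l : ℕ) (T : Cor22.ThetaVolumeDatumAt P l), Type} {IsoS : ∀ (P : NFPoint) (l : ℕ) (T : Cor22.ThetaVolumeDatumAt P l), Strip P l T → Strip P l T → Type}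
    {Mv : ∀ (P : NFPoint) (l : ℕ) (T : Cor22.ThetaVolumeDatumAt P l), letI := T.instFieldF; letI := T.instNumberFieldF; letI := T.instAlgebraF; letI := T.instFieldK;
        letI := T.instNumberFieldK; letI := T.instAlgebraK; letI := T.instFieldFbar; letI := T.instAlgebraFbar;
        letI := T.instAlgebraKFbar; letI := T.instIsElliptic;
      ∀ v : (thetaIndex (pilotDataOfK T.D T.K)).V, v ∈ (thetaIndex (pilotDataOfK T.D T.K)).Vbad → Type}
    [∀ P l T v h, Monoid (Mv P l T v h)]
    (sig : ∀ (P : NFPoint) (l : ℕ) (T : Cor22.ThetaVolumeDatumAt P l), letI := T.instFieldF; letI := T.instNumberFieldF; letI := T.instAlgebraF; letI := T.instFieldK;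
        letI := T.instNumberFieldK; letI := T.instAlgebraK; letI := T.instFieldFbar; letI := T.instAlgebraFbar;
        letI := T.instAlgebraKFbar; letI := T.instIsElliptic;
      GlobalLGPFrobenioidSignature (thetaIndex (pilotDataOfK T.D T.K)).lstar (thetaIndex (pilotDataOfK T.D T.K)).V (· ∈ (thetaIndex (pilotDataOfK T.D T.K)).Vbad) (Frd P l T) (IsoF P l T) (Ob P l T) (realify P l T)
        (Strip P l T) (IsoS P l T) (Mv P l T))
    (split : ∀ (P : NFPoint) (l : ℕ) (T : Cor22.ThetaVolumeDatumAt P l), SplittingMonoids (Mv P l T))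
    {ObΔ : ∀ (P : NFPoint) (l : ℕ) (T : Cor22.ThetaVolumeDatumAt P l), Type} {N : ∀ (P : NFPoint) (l : ℕ) (T : Cor22.ThetaVolumeDatumAt P l), letI := T.instFieldF; letI := T.instNumberFieldF; letI := T.instAlgebraF; letI := T.instFieldK;
        letI := T.instNumberFieldK; letI := T.instAlgebraK; letI := T.instFieldFbar; letI := T.instAlgebraFbar;
        letI := T.instAlgebraKFbar; letI := T.instIsElliptic;
      ∀ v : (thetaIndex (pilotDataOfK T.D T.K)).V, v ∈ (thetaIndex (pilotDataOfK T.D T.K)).Vbad → Type}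
    [∀ P l T v h, Monoid (N P l T v h)] (qData : ∀ (P : NFPoint) (l : ℕ) (T : Cor22.ThetaVolumeDatumAt P l), QPilotData (ObΔ P l T) (N P l T))
    (qK : ∀ (P : NFPoint) (l : ℕ) (T : Cor22.ThetaVolumeDatumAt P l), letI := T.instFieldF; letI := T.instNumberFieldF; letI := T.instAlgebraF; letI := T.instFieldK;
        letI := T.instNumberFieldK; letI := T.instAlgebraK; letI := T.instFieldFbar; letI := T.instAlgebraFbar;
        letI := T.instAlgebraKFbar; letI := T.instIsElliptic;
      ∀ v : (thetaIndex (pilotDataOfK T.D T.K)).V, v ∈ (thetaIndex (pilotDataOfK T.D T.K)).Vbad → Set ((logShellsDH (pilotDataOfK T.D T.K) (analyticLogv T.K)).StarPacket v))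
    (hNumOffC : ∀ (P : NFPoint), P ∈ UP → ∀ (l : ℕ), l.Prime → 5 ≤ l →
      Cor22.AdmitsCore P → Cor22.CondP2 P l → Cor22.CondP5 P l → Cor22.CondP6 P l →
      -- ONLY on the CONTENT LOCUS of [IUTchIV] Thm. 1.10's display (`display_of_not_content`: off it the display holds for every `η > 0`;
      -- the guard implies the Szpiro-bad guard of p457468, `szpiroBad_of_content`)
      6 * ((1 + 20 * (Cor22.dmod P : ℝ) / l) * (P.logDiff + Cor22.logCondAvoid P {2, l}))
          + 120 * (2 ^ 12 * 3 ^ 3 * 5 * (Cor22.dmod P : ℝ) * l) < Cor22.logQAvoid P {2, l} →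
      ∀ (T : Cor22.ThetaVolumeDatumAt P l), letI := T.instFieldF; letI := T.instNumberFieldF; letI := T.instAlgebraF; letI := T.instFieldK;
        letI := T.instNumberFieldK; letI := T.instAlgebraK; letI := T.instFieldFbar; letI := T.instAlgebraFbar;
        letI := T.instAlgebraKFbar; letI := T.instIsElliptic;
      -- … and ONLY where OUR typed licence FAILS at the chosen ideles / pinned reading:
      ¬ (Cor312Vol.PilotKummerCompatHull
        (LatticeSituation.ofShells (logShellsDH (pilotDataOfK T.D T.K) (analyticLogv T.K)) (M P l T) (archPk P l T)
          (archSub P l T) (summandPiecesPr (pilotDataOfK T.D T.K) (logvAnalytic_analyticLogv (F := T.K))).Adm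
          (summandPiecesPr (pilotDataOfK T.D T.K) (logvAnalytic_analyticLogv (F := T.K))).logvol (Ψ P l T) (act P l T) (Mmod P l T)
          (region P l T) (frobAdm P l T) (frobLogvol P l T) (frobΨ P l T) (frobMmod P l T) (unitImage P l T)
          (ballImage P l T) (thetaDiv P l T))
        (settingPrVolSharp (pilotDataOfK T.D T.K) (logvAnalytic_analyticLogv (F := T.K)) (M P l T) (archPk P l T) (archSub P l T) (Ψ P l T)
          (act P l T) (Mmod P l T) (region P l T) (n P l T) (lat P l T) (sig P l T) (split P l T) (qData P l T)
          (exists_realising_qIdeles_pilotDataOfK T.D).choose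
          (exists_realising_thetaIdeles_pilotDataOfK T.D).choose
          (exists_realising_qIdeles_pilotDataOfK T.D).choose_spec.1
          (exists_realising_qIdeles_pilotDataOfK T.D).choose_spec.2.1)
        (fun _ => Cor312.Setting.qRegion
        (settingPrVolSharp (pilotDataOfK T.D T.K) (logvAnalytic_analyticLogv (F := T.K)) (M P l T) (archPk P l T) (archSub P l T) (Ψ P l T)
          (act P l T) (Mmod P l T) (region P l T) (n P l T) (lat P l T) (sig P l T) (split P l T) (qData P l T)
          (exists_realising_qIdeles_pilotDataOfK T.D).choose
          (exists_realising_thetaIdeles_pilotDataOfK T.D).choose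
          (exists_realising_qIdeles_pilotDataOfK T.D).choose_spec.1
          (exists_realising_qIdeles_pilotDataOfK T.D).choose_spec.2.1)) (qK P l T)) → T.Cor312Of)
    -- [NUM-1.10, content ∧ mixing] [IUTchIV] Thm 1.10 Step (viii)'s squeeze at the admissible points ON THE CONTENT LOCUS and IN the mixing locus
    -- (the negation of abc-iut-s2-p1's off-locus condition of `Conditional.hvol_offMixingLocus_holds`, VERBATIM)
    (hSqMixC : ∀ P : NFPoint, P ∈ UP → ∀ l : ℕ, l.Prime → 5 ≤ l →
      Cor22.AdmitsCore P → Cor22.CondP2 P l → Cor22.CondP5 P l → Cor22.CondP6 P l →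
      6 * ((1 + 20 * (Cor22.dmod P : ℝ) / l) * (P.logDiff + Cor22.logCondAvoid P {2, l}))
          + 120 * (2 ^ 12 * 3 ^ 3 * 5 * (Cor22.dmod P : ℝ) * l) < Cor22.logQAvoid P {2, l} →
      ¬ (∃ M : Finset ℕ,
        (∀ p : ℕ, p.Prime →
          (¬ ∀ V W : HeightOneSpectrum (𝓞 ↥(IntermediateField.adjoin ℚ ({Cor22.jInv P.x} : Set P.F))),
            V ∈ placesOver _ p → W ∈ placesOver _ p →
            (if ord _ V (Cor22.jMod P) < 0 ∧ ((2 : ℕ) : 𝓞 _) ∉ V.asIdeal ∧ ((l : ℕ) : 𝓞 _) ∉ V.asIdeal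
              then ((-ord _ V (Cor22.jMod P) : ℤ) : ℝ) * logNorm _ V / (localDegree _ V : ℝ) else 0) =
            (if ord _ W (Cor22.jMod P) < 0 ∧ ((2 : ℕ) : 𝓞 _) ∉ W.asIdeal ∧ ((l : ℕ) : 𝓞 _) ∉ W.asIdeal
              then ((-ord _ W (Cor22.jMod P) : ℤ) : ℝ) * logNorm _ W / (localDegree _ W : ℝ) else 0)) → p ∈ M) ∧
        ((l : ℝ) + 1) / 24 *
            ∑ p ∈ M, ∑ V : placesOver ↥(IntermediateField.adjoin ℚ ({Cor22.jInv P.x} : Set P.F)) p,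
              (if ord _ V.1 (Cor22.jMod P) < 0 ∧ ((2 : ℕ) : 𝓞 _) ∉ V.1.asIdeal ∧ ((l : ℕ) : 𝓞 _) ∉ V.1.asIdeal then
                weight _ V.1 * (((-ord _ V.1 (Cor22.jMod P) : ℤ) : ℝ) * logNorm _ V.1 / (localDegree _ V.1 : ℝ))
               else 0) ≤
          ((l : ℝ) + 1) / 4 * (4 * ((Cor22.dmod P : ℝ) - 1) / l * (P.logDiff + Cor22.logCondAvoid P {2, l})
            + 20 / 3 * Real.log (((2 ^ 12 * 3 ^ 3 * 5 * Cor22.dmod P : ℕ) : ℝ) * l)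
              * max 0 (((Nat.primeCounting (2 ^ 12 * 3 ^ 3 * 5 * Cor22.dmod P * l) : ℝ)
                - (2 * (Cor22.dmod P : ℝ) * (P.logDiff + Cor22.logCondAvoid P {2, l}) + Real.log (2 * 3 * 5 * (l : ℝ)))
                  / Real.log 2)))) →
      (((l : ℝ) + 1) / 24 - 1 / (2 * l)) * Cor22.logQAvoid P {2, l} ≤
        ((l : ℝ) + 1) / 4 *
          ((1 + 12 * (Cor22.dmod P : ℝ) / l) * (P.logDiff + Cor22.logCondAvoid P {2, l})
            + 2 * Real.log l + 52
            + 20 / 3 * Real.log (((2 ^ 12 * 3 ^ 3 * 5 * Cor22.dmod P : ℕ) : ℝ) * (l : ℝ))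
              * (Nat.primeCounting (2 ^ 12 * 3 ^ 3 * 5 * Cor22.dmod P * l) : ℝ))
        + ThetaVolumeInput.archLogTheta l)
    : _root_.ABC := by
  refine ABC_of_squeezeIII_content fun P hP l hl h5 hc h2 h5' h6 hct => ?_
  obtain ⟨T⟩ := ThetaPartII.stub_thetaData P hP l hl h5 hc h2 h5' h6
  have h7 : 7 ≤ l := ThetaPartII.seven_le_of_condP6 hP hl h5 h6
  -- `Cor22.Cor312AtDatum P l` ON THE CONTENT LOCUS, per datum (p457468's lines with `hbad ↦ hct`): licence HOLDS ⇒ `GenuineK.cor312Of_of_SH`;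
  -- FAILS ⇒ `hNumOffC`
  have h312 : Cor22.Cor312AtDatum P l := by
    intro T'
    letI := T'.instFieldF; letI := T'.instNumberFieldF; letI := T'.instAlgebraF; letI := T'.instFieldK
    letI := T'.instNumberFieldK; letI := T'.instAlgebraK; letI := T'.instFieldFbar; letI := T'.instAlgebraFbar
    letI := T'.instAlgebraKFbar; letI := T'.instIsElliptic
    by_cases hS : (Cor312Vol.PilotKummerCompatHull
          (LatticeSituation.ofShells (logShellsDH (pilotDataOfK T'.D T'.K) (analyticLogv T'.K)) (M P l T') (archPk P l T')
            (archSub P l T') (summandPiecesPr (pilotDataOfK T'.D T'.K) (logvAnalytic_analyticLogv (F := T'.K))).Adm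
            (summandPiecesPr (pilotDataOfK T'.D T'.K) (logvAnalytic_analyticLogv (F := T'.K))).logvol (Ψ P l T') (act P l T') (Mmod P l T')
            (region P l T') (frobAdm P l T') (frobLogvol P l T') (frobΨ P l T') (frobMmod P l T') (unitImage P l T')
            (ballImage P l T') (thetaDiv P l T'))
          (settingPrVolSharp (pilotDataOfK T'.D T'.K) (logvAnalytic_analyticLogv (F := T'.K)) (M P l T') (archPk P l T') (archSub P l T') (Ψ P l T')
            (act P l T') (Mmod P l T') (region P l T') (n P l T') (lat P l T') (sig P l T') (split P l T') (qData P l T')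
            (exists_realising_qIdeles_pilotDataOfK T'.D).choose
            (exists_realising_thetaIdeles_pilotDataOfK T'.D).choose
            (exists_realising_qIdeles_pilotDataOfK T'.D).choose_spec.1
            (exists_realising_qIdeles_pilotDataOfK T'.D).choose_spec.2.1)
          (fun _ => Cor312.Setting.qRegion
          (settingPrVolSharp (pilotDataOfK T'.D T'.K) (logvAnalytic_analyticLogv (F := T'.K)) (M P l T') (archPk P l T') (archSub P l T') (Ψ P l T')
            (act P l T') (Mmod P l T') (region P l T') (n P l T') (lat P l T') (sig P l T') (split P l T') (qData P l T')
            (exists_realising_qIdeles_pilotDataOfK T'.D).choose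
            (exists_realising_thetaIdeles_pilotDataOfK T'.D).choose
            (exists_realising_qIdeles_pilotDataOfK T'.D).choose_spec.1
            (exists_realising_qIdeles_pilotDataOfK T'.D).choose_spec.2.1)) (qK P l T'))
    · exact GenuineK.cor312Of_of_SH T'.D T'.K (M P l T') (archPk P l T') (archSub P l T') (Ψ P l T') (act P l T') (Mmod P l T')
        (region P l T') (frobAdm P l T') (frobLogvol P l T') (frobΨ P l T') (frobMmod P l T') (unitImage P l T') (ballImage P l T')
        (thetaDiv P l T') (n P l T') (lat P l T') (sig P l T') (split P l T') (qData P l T')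
        (exists_realising_thetaIdeles_pilotDataOfK T'.D).choose (exists_realising_qIdeles_pilotDataOfK T'.D).choose
        (fun _ => Cor312.Setting.qRegion
            (settingPrVolSharp (pilotDataOfK T'.D T'.K) (logvAnalytic_analyticLogv (F := T'.K)) (M P l T') (archPk P l T') (archSub P l T') (Ψ P l T')
            (act P l T') (Mmod P l T') (region P l T') (n P l T') (lat P l T') (sig P l T') (split P l T') (qData P l T')
            (exists_realising_qIdeles_pilotDataOfK T'.D).choose
            (exists_realising_thetaIdeles_pilotDataOfK T'.D).choose
            (exists_realising_qIdeles_pilotDataOfK T'.D).choose_spec.1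
            (exists_realising_qIdeles_pilotDataOfK T'.D).choose_spec.2.1)) (qK P l T')
        T'.isVolumeInputOf (exists_realising_qIdeles_pilotDataOfK T'.D).choose_spec.1
        (exists_realising_qIdeles_pilotDataOfK T'.D).choose_spec.2.1 (exists_realising_thetaIdeles_pilotDataOfK T'.D).choose_spec.1
        (exists_realising_thetaIdeles_pilotDataOfK T'.D).choose_spec.2.1 (exists_realising_qIdeles_pilotDataOfK T'.D).choose_spec.2.2
        hS (fun _ _ => rfl)
        (negLogTheta_settingPrVolSharp_pilotDataOfK_le_datum T' (M P l T') (archPk P l T') (archSub P l T') (Ψ P l T') (act P l T')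
          (Mmod P l T') (region P l T') (n P l T') (lat P l T') (sig P l T') (split P l T') (qData P l T')
          (exists_realising_qIdeles_pilotDataOfK T'.D).choose (exists_realising_thetaIdeles_pilotDataOfK T'.D).choose
          (exists_realising_qIdeles_pilotDataOfK T'.D).choose_spec.1 (exists_realising_qIdeles_pilotDataOfK T'.D).choose_spec.2.1
          (exists_realising_thetaIdeles_pilotDataOfK T'.D).choose_spec.1 (exists_realising_thetaIdeles_pilotDataOfK T'.D).choose_spec.2.2)
    · exact hNumOffC P hP l hl h5 hc h2 h5' h6 hct T' hS
  -- the squeeze ON THE CONTENT LOCUS: OFF the mixing locus by abc-iut-s2-p1's hull estimate (p455026) + abc-iut-S2's squeeze, ON it by `hSqMixC`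
  by_cases hOff : (∃ M : Finset ℕ,
      (∀ p : ℕ, p.Prime →
        (¬ ∀ V W : HeightOneSpectrum (𝓞 ↥(IntermediateField.adjoin ℚ ({Cor22.jInv P.x} : Set P.F))),
          V ∈ placesOver _ p → W ∈ placesOver _ p →
          (if ord _ V (Cor22.jMod P) < 0 ∧ ((2 : ℕ) : 𝓞 _) ∉ V.asIdeal ∧ ((l : ℕ) : 𝓞 _) ∉ V.asIdeal
            then ((-ord _ V (Cor22.jMod P) : ℤ) : ℝ) * logNorm _ V / (localDegree _ V : ℝ) else 0) =
          (if ord _ W (Cor22.jMod P) < 0 ∧ ((2 : ℕ) : 𝓞 _) ∉ W.asIdeal ∧ ((l : ℕ) : 𝓞 _) ∉ W.asIdeal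
            then ((-ord _ W (Cor22.jMod P) : ℤ) : ℝ) * logNorm _ W / (localDegree _ W : ℝ) else 0)) → p ∈ M) ∧
      ((l : ℝ) + 1) / 24 *
          ∑ p ∈ M, ∑ V : placesOver ↥(IntermediateField.adjoin ℚ ({Cor22.jInv P.x} : Set P.F)) p,
            (if ord _ V.1 (Cor22.jMod P) < 0 ∧ ((2 : ℕ) : 𝓞 _) ∉ V.1.asIdeal ∧ ((l : ℕ) : 𝓞 _) ∉ V.1.asIdeal then
              weight _ V.1 * (((-ord _ V.1 (Cor22.jMod P) : ℤ) : ℝ) * logNorm _ V.1 / (localDegree _ V.1 : ℝ))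
             else 0) ≤
        ((l : ℝ) + 1) / 4 * (4 * ((Cor22.dmod P : ℝ) - 1) / l * (P.logDiff + Cor22.logCondAvoid P {2, l})
          + 20 / 3 * Real.log (((2 ^ 12 * 3 ^ 3 * 5 * Cor22.dmod P : ℕ) : ℝ) * l)
            * max 0 (((Nat.primeCounting (2 ^ 12 * 3 ^ 3 * 5 * Cor22.dmod P * l) : ℝ)
              - (2 * (Cor22.dmod P : ℝ) * (P.logDiff + Cor22.logCondAvoid P {2, l}) + Real.log (2 * 3 * 5 * (l : ℝ)))
                / Real.log 2))))
  · exact PointDict.logQAvoid_le_of_cor312AtDatum h312 (hvol_offMixingLocus_holds P hP l hl h5 hc h2 h5' h6 hOff) T hP.1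
  · exact hSqMixC P hP l hl h5 hc h2 h5' h6 hct hOff

end Summit.ABC.IUTFork.Conditional

end
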